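import Summits.BirchSwinnertonDyer.BirchSwinnertonDyer.Theorems.PublishedInputsGreenbergLemma34WeilScalar
import Summits.BirchSwinnertonDyer.BirchSwinnertonDyer.Theorems.ByReductionTypeAtTwoGoodOrdTowerControlLayerFormalP
import HarnessLib

set_option linter.dupNamespace false -- `…BirchSwinnertonDyer.BirchSwinnertonDyer…` is the cell's nested layout (D-0017)
set_option autoImplicit false

/-!
# Greenberg LNM 1716 Lemma 3.4 at `n = 0`, step 3b: the EXACT count `#H²(Γ_{F}, Ê[p^k]) = #(Ê[p^k])^{τ}`
# (local duality `(2,0)` + the Weil identity `χ = ψφ` + Hensel)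

Seat `bsd-inputs-k4-p1` (gen 5; LADDER-BSD D-0154 KEY (147)(f) «prove the printed input», row 1 K4 INPUTS; Greenberg
1999), `--supports stmt-BirchSwinnertonDyer-20309`. THEOREMS ONLY (no definition, no named fact, no `sorry`).

R. Greenberg, *Iwasawa theory for elliptic curves*, LNM 1716 (1999), §2 pp. 78–80 (Prop. 2.5 via Poitou–Tate:
"`H²(M, T)` is dual to `Hom_{G_M}(T, μ_{p^∞})` … can be identified with the dual of `H⁰(M, (ℚ_p/ℤ_p)(χψ⁻¹))`", and
`χψ⁻¹ = φ`, so the count is `|Ẽ(m)_p|`). Finite-level, points-currency version for `C = Ê[p^k] = ker red₀ ∩ E[p^k]`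
(cyclic of order `p^k` on `P_k`): the tree's local duality `natCard_two_eq_natCard_invariants_homRep` gives
`#H²(Γ_F, C) = #Hom_{Γ_F}(C, μ_{p^k})`; cell bsd-2adic's `natCard_equivariant_le_card_filter` bounds the latter by the
`τ`-fixed part of `C` for ONE Frobenius `τ` fixing `μ_{p^∞}`. EQUALITY: a `τ`-equivariant `f : C → μ_{p^k}` is
`Γ_F`-equivariant. Indeed if `z = f(P_k)` has order `p^{j'}` then `τ` fixes `C[p^{j'}]`, so `j' ≤ j` where
`C^τ = C[p^j]`; `τ` then fixes `E[p^j]` modulo `ker red₀` (Weil identity for `τ`, `χ(τ) = 1`), hence — by HENSEL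
(`τ`-fixed reductions lift to `Γ_F`-fixed points) — so does every `σ ∈ Γ_F`; the Weil identity for `σ`
(`localPoints_exists_nsmul_smul_sub_nsmul_eq_nsmul`: `b_σ σQ − a_σ Q ∈ ℤP`) read modulo `ker red₀` gives
`(b_σ − a_σ) · Ẽ[p^j] = 0`, and `Ẽ[p^j]` has an element of order `p^j` (`#Ẽ[p^j] = p^j`, `#Ẽ[p^{j−1}] = p^{j−1}`), so
`p^j ∣ b_σ − a_σ` and `b_σ z = a_σ z`, i.e. `f(σ P_k) = σ f(P_k)`.

* `natCard_H2_formalTorsion_eq_natCard_fixed` — for a non-archimedean local field `F` of characteristic `0` over `K`, a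
  curve `W/K`, an abstract reduction `red₀ : E(K̄_F) → B` with the ordinary-filtration package (`hstab`, `hgenr`,
  `hsurj`), a Frobenius `τ` fixing `μ_{p^∞}` with the Hensel property (`hHensel`), and `C = ker red₀ ∩ E(K̄_F)[p^k]`
  with its Galois representation `ρ`: **`#H²(Γ_F, C) = #{c ∈ C : τ c = c}`**.

HONEST FRAMING: a local TOOL theorem with displayed hypotheses (discharged over `ℚ` at a good ordinary `p` in the
sequel); closes nothing; no summit statement is proved; BSD is not proved by any of this.

References: [GreenbergLNM1716] §2 pp. 78–80 (Props. 2.2, 2.5), §3 Lemma 3.4 (p. 89); [MilneADT2006] I Cor. 2.3;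
[SilvermanAEC2009] III.8.1, VII.2.1.
-/

noncomputable section

open scoped Classical AddSubgroup

universe u v

namespace Summit.BirchSwinnertonDyer.BirchSwinnertonDyer.Theorems.InputsGreenbergLemma34

open Field Literature.NumberTheory.EllipticCurves Literature.NumberTheory.GaloisRepresentations
  Literature.NumberTheory.GaloisRepresentations.DiscreteGaloisModule _root_.ContinuousCohomology WeierstrassCurve

variable {K : Type u} [Field K] (W : WeierstrassCurve K) [W.IsElliptic]
  (F : Type u) [Field F] [ValuativeRel F] [TopologicalSpace F] [IsNonarchimedeanLocalField F] [CharZero F]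
  [Algebra K F] {p : ℕ} [hp : Fact p.Prime]

set_option maxHeartbeats 3200000 in
/-- **`#H²(Γ_F, Ê[p^k]) = #(Ê[p^k])^τ` — the exact `H²` count of Greenberg's Prop. 2.5 / Lemma 3.4 at finite level.**
`F` a non-archimedean local field of characteristic `0` over `K`, `W/K` elliptic, `red₀ : E(K̄_F) → B` additive with
`Γ_F`-stable kernel (`hstab`), `ker red₀ ∩ E[p^r]` cyclic of order `p^r` on a generator (`hgenr`) and `red₀(E[p^r]) = B[p^r]`
(`hsurj`) for all `r`; `τ ∈ Γ_F` fixing every `p`-power root of unity, with the Hensel property `hHensel` (a point whose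
reduction is `τ`-fixed has a `Γ_F`-fixed point with the same reduction); `C = ker red₀ ∩ E(K̄_F)[p^k]` carried by the
continuous representation `ρ` acting as Galois (`hρ`). Then `#H²(Γ_F, C) = #{c ∈ C : τ c = c}`. See the module
docstring for the proof. [cite: GreenbergLNM1716, §2 Prop. 2.5 (pp. 78–80), §3 Lemma 3.4 (p. 89)] [cite: MilneADT2006, I Cor. 2.3]
[cite: SilvermanAEC2009, Prop. III.8.1] -/
theorem natCard_H2_formalTorsion_eq_natCard_fixed {B : Type v} [AddCommGroup B]
    (red₀ : localPoints W F →+ B)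
    (hstab : ∀ (σ : absoluteGaloisGroup F) (Q : localPoints W F), red₀ Q = 0 → red₀ (σ • Q) = 0)
    (hgenr : ∀ r : ℕ, ∃ P₁ : localPoints W F, red₀ P₁ = 0 ∧ addOrderOf P₁ = p ^ r ∧
      ∀ P : localPoints W F, red₀ P = 0 → ((p ^ r : ℕ) : ℤ) • P = 0 → ∃ c : ℕ, P = c • P₁)
    (hsurj : ∀ (r : ℕ) (y : B), ((p ^ r : ℕ) : ℤ) • y = 0 →
      ∃ x : localPoints W F, ((p ^ r : ℕ) : ℤ) • x = 0 ∧ red₀ x = y)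
    {τ : absoluteGaloisGroup F} (hτfix : ∀ (r : ℕ) (ξ : AlgebraicClosure F), ξ ^ p ^ r = 1 → τ • ξ = ξ)
    (hHensel : ∀ Q : localPoints W F, red₀ (τ • Q) = red₀ Q →
      ∃ P₀ : localPoints W F, (∀ σ : absoluteGaloisGroup F, σ • P₀ = P₀) ∧ red₀ P₀ = red₀ Q)
    (k : ℕ) (C : AddSubgroup (localPoints W F)) (hC : ∀ a, a ∈ C ↔ red₀ a = 0 ∧ p ^ k • a = 0)
    (ρ : ContinuousRep (absoluteGaloisGroup F) ℤ C)
    (hρ : ∀ (σ : absoluteGaloisGroup F) (c : C), ((ρ σ c : C) : localPoints W F) = σ • (c : localPoints W F)) :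
    Finite (continuousCohomology 2 ρ.toTopRep) ∧
      Nat.card (continuousCohomology 2 ρ.toTopRep) = Nat.card {c : C // τ • (c : localPoints W F) = c} := by
  -- notation
  let P : Type u := localPoints W F
  let Γ := absoluteGaloisGroup F
  haveI : CompactSpace Γ := absoluteGaloisGroup_compactSpace F
  haveI : NeZero (p ^ k) := ⟨pow_ne_zero k hp.out.ne_zero⟩
  haveI : NeZero (p : F) := ⟨Nat.cast_ne_zero.mpr hp.out.ne_zero⟩
  have hpr : ∀ r : ℕ, p ^ r ≠ 0 := fun r ↦ pow_ne_zero r hp.out.ne_zero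
  have galois_smul_nsmul : ∀ (σ : Γ) (n : ℕ) (Q : P), σ • (n • Q) = n • (σ • Q) :=
    fun σ n Q ↦ map_nsmul (DistribSMul.toAddMonoidHom P σ) n Q
  -- the generator `P_k` of `C`
  obtain ⟨Pk, hPk0, hPkord, hPkgen⟩ := hgenr k
  have hPkp : p ^ k • Pk = 0 := by rw [← hPkord]; exact addOrderOf_nsmul_eq_zero Pk
  have hPkC : Pk ∈ C := (hC Pk).mpr ⟨hPk0, hPkp⟩
  let Pz : C := ⟨Pk, hPkC⟩
  have hZgen : ∀ z : C, ∃ i : ℕ, z = i • Pz := fun z ↦ by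
    obtain ⟨c, hc⟩ := hPkgen z ((hC z).mp z.2).1 (by rw [natCast_zsmul]; exact ((hC z).mp z.2).2)
    exact ⟨c, Subtype.ext (by rw [AddSubmonoidClass.coe_nsmul]; exact hc)⟩
  have hPzord : addOrderOf Pz = p ^ k := by rw [← AddSubgroup.addOrderOf_coe Pz]; exact hPkord
  have hZcard : Nat.card C = p ^ k := by
    have h : (AddSubgroup.zmultiples Pz : AddSubgroup C) = ⊤ := by
      rw [eq_top_iff]
      intro z _
      obtain ⟨i, hi⟩ := hZgen z
      exact hi ▸ AddSubgroup.nsmul_mem _ (AddSubgroup.mem_zmultiples Pz) i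
    rw [← hPzord, ← Nat.card_zmultiples Pz, h, AddSubgroup.card_top]
  haveI hZfin : Finite C := Nat.finite_of_card_ne_zero (by rw [hZcard]; exact hpr k)
  haveI hZcyc : IsAddCyclic C :=
    ⟨⟨Pz, fun z ↦ by
      obtain ⟨i, hi⟩ := hZgen z
      exact ⟨(i : ℤ), by change (i : ℤ) • Pz = z; rw [natCast_zsmul, hi]⟩⟩⟩
  have hZp : ∀ z : C, p ^ k • z = 0 := fun z ↦ Subtype.ext (by
    rw [AddSubmonoidClass.coe_nsmul, ZeroMemClass.coe_zero]; exact ((hC z).mp z.2).2)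
  -- the scalar `b σ` of `σ` on `P_k`, and `ρ σ (i P_k) = (i b σ) P_k`
  have hbex : ∀ σ : Γ, ∃ b : ℕ, σ • Pk = b • Pk := fun σ ↦
    hPkgen (σ • Pk) (hstab σ Pk hPk0) (by rw [natCast_zsmul, ← galois_smul_nsmul, hPkp, smul_zero])
  choose bσ hbσ using hbex
  have hρPz : ∀ σ : Γ, ρ σ Pz = bσ σ • Pz := fun σ ↦
    Subtype.ext (by rw [hρ, AddSubmonoidClass.coe_nsmul]; exact hbσ σ)
  have hρi : ∀ (σ : Γ) (i : ℕ), ρ σ (i • Pz) = (i * bσ σ) • Pz := fun σ i ↦ by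
    rw [map_nsmul, hρPz, smul_smul]
  have hτc : ∀ (σ : Γ) (c : C), σ • (c : P) = ((bσ σ • c : C) : P) := fun σ c ↦ by
    obtain ⟨i, rfl⟩ := hZgen c
    simp only [AddSubmonoidClass.coe_nsmul]
    change σ • (i • Pk) = bσ σ • (i • Pk)
    rw [galois_smul_nsmul, hbσ σ, smul_smul, smul_smul, mul_comm]
  -- the cyclotomic character: `σ ξ = ξ^{a σ}` on `μ_{p^k}`, and on `μ_{p^j}`, `j ≤ k`
  let aσ : Γ → ℕ := fun σ ↦ ((GaloisRep.cyclotomicCharacter F p σ).val.toZModPow k).val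
  have haσ : ∀ (σ : Γ) (ξ : AlgebraicClosure F), ξ ^ p ^ k = 1 → σ • ξ = ξ ^ aσ σ := fun σ ξ hξ ↦
    GaloisRep.cyclotomicCharacter_spec F p σ ξ hξ
  have haσ' : ∀ (σ : Γ) (j : ℕ), j ≤ k → ∀ ξ : AlgebraicClosure F, ξ ^ p ^ j = 1 → σ • ξ = ξ ^ aσ σ := by
    intro σ j hj ξ hξ
    refine haσ σ ξ ?_
    obtain ⟨d, hd⟩ := Nat.exists_eq_add_of_le hj
    rw [hd, pow_add, pow_mul, hξ, one_pow]
  -- `σ` acts on `μ_{p^k}` (`MuCarrier`) by `a σ`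
  have hσω : ∀ (σ : Γ) (z : MuCarrier F (p ^ k)), mu F (p ^ k) σ z = aσ σ • z := by
    intro σ z
    have hu1 : (((MuCarrier.toAdditive z).toMul : (AlgebraicClosure F)ˣ) : AlgebraicClosure F) ^ p ^ k = 1 := by
      have h' := ((MuCarrier.toAdditive z).toMul).2
      rw [mem_rootsOfUnity] at h'
      rw [← Units.val_pow_eq_pow_val, h', Units.val_one]
    apply MuCarrier.toAdditive.injective
    rw [mu_apply_apply, map_nsmul]
    change _ = Additive.ofMul ((MuCarrier.toAdditive z).toMul ^ aσ σ)
    refine congrArg Additive.ofMul (Subtype.ext (Units.ext ?_))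
    rw [absoluteGaloisGroup.coe_smul_rootsOfUnity, Units.coe_smul, haσ σ _ hu1]
    simp only [SubmonoidClass.coe_pow, Units.val_pow_eq_pow_val]
  have hτω : ∀ z : MuCarrier F (p ^ k), mu F (p ^ k) τ z = z := by
    intro z
    have hu1 : (((MuCarrier.toAdditive z).toMul : (AlgebraicClosure F)ˣ) : AlgebraicClosure F) ^ p ^ k = 1 := by
      have h' := ((MuCarrier.toAdditive z).toMul).2
      rw [mem_rootsOfUnity] at h'
      rw [← Units.val_pow_eq_pow_val, h', Units.val_one]
    apply MuCarrier.toAdditive.injective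
    rw [mu_apply_apply]
    refine congrArg Additive.ofMul (Subtype.ext (Units.ext ?_))
    rw [absoluteGaloisGroup.coe_smul_rootsOfUnity, Units.coe_smul]
    exact hτfix k _ hu1
  have hμp : ∀ z : MuCarrier F (p ^ k), p ^ k • z = 0 := fun z ↦ by
    have h : Nat.card (MuCarrier F (p ^ k)) • z = 0 := card_nsmul_eq_zero'
    rwa [Nat.card_congr (muEquivZMod F (p ^ k)).toEquiv, Nat.card_zmod] at h
  -- (1) local duality `(2,0)`
  obtain ⟨hfin2, hcard2⟩ := natCard_two_eq_natCard_invariants_homRep F ρ hZp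
  refine ⟨hfin2, ?_⟩
  rw [hcard2]
  -- (2) the `τ`-fixed part `D` of `C`: `#D = p^j`, `D = ker red₀ ∩ E[p^j]`
  let Cr : ℕ → AddSubgroup P := fun r ↦ red₀.ker ⊓ AddSubgroup.torsionBy P ((p ^ r : ℕ) : ℤ)
  have hmemC : ∀ (r : ℕ) (Q : P), Q ∈ Cr r ↔ red₀ Q = 0 ∧ ((p ^ r : ℕ) : ℤ) • Q = 0 := fun r Q ↦ by
    change Q ∈ red₀.ker ⊓ AddSubgroup.torsionBy P ((p ^ r : ℕ) : ℤ) ↔ _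
    rw [AddSubgroup.mem_inf, AddMonoidHom.mem_ker, mem_torsionBy_iff]
  have hCrgen : ∀ r : ℕ, ∃ P₁ ∈ Cr r, addOrderOf P₁ = p ^ r ∧ Cr r = AddSubgroup.zmultiples P₁ := by
    intro r
    obtain ⟨P₁, hP₁, hord₁, hgen₁⟩ := hgenr r
    have hP₁C : P₁ ∈ Cr r := (hmemC r P₁).mpr ⟨hP₁, by rw [natCast_zsmul, ← hord₁, addOrderOf_nsmul_eq_zero]⟩
    refine ⟨P₁, hP₁C, hord₁, le_antisymm ?_ (AddSubgroup.zmultiples_le.mpr hP₁C)⟩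
    intro Q hQ
    obtain ⟨c, rfl⟩ := hgen₁ Q ((hmemC r Q).mp hQ).1 ((hmemC r Q).mp hQ).2
    exact AddSubgroup.mem_zmultiples_iff.mpr ⟨c, natCast_zsmul P₁ c⟩
  have hcardC : ∀ r : ℕ, Nat.card (Cr r) = p ^ r := fun r ↦ by
    obtain ⟨P₁, -, hord₁, hCeq⟩ := hCrgen r
    rw [hCeq, Nat.card_zmultiples, hord₁]
  have hfinC : ∀ r : ℕ, Finite (Cr r) := fun r ↦ Nat.finite_of_card_ne_zero (by rw [hcardC]; exact hpr r)
  have hCk : ∀ Q : P, Q ∈ Cr k ↔ Q ∈ C := fun Q ↦ by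
    rw [hmemC, hC, natCast_zsmul]
  let D : AddSubgroup P :=
    { carrier := {Q | Q ∈ Cr k ∧ τ • Q = Q}
      zero_mem' := ⟨(Cr k).zero_mem, smul_zero τ⟩
      add_mem' := fun {a b} ha hb ↦ ⟨(Cr k).add_mem ha.1 hb.1, by rw [smul_add, ha.2, hb.2]⟩
      neg_mem' := fun {a} ha ↦ ⟨(Cr k).neg_mem ha.1, by rw [smul_neg, ha.2]⟩ }
  have hmemD : ∀ Q, Q ∈ D ↔ Q ∈ Cr k ∧ τ • Q = Q := fun Q ↦ Iff.rfl
  have hDle : D ≤ Cr k := fun Q hQ ↦ hQ.1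
  haveI : Finite (Cr k) := hfinC k
  haveI : Finite D := Finite.of_injective (fun x : D ↦ (⟨x.1, hDle x.2⟩ : Cr k))
    fun a b h ↦ Subtype.ext (congrArg (fun z : Cr k ↦ (z : P)) h)
  obtain ⟨j, hjk, hDcard⟩ : ∃ j ≤ k, Nat.card D = p ^ j :=
    (Nat.dvd_prime_pow hp.out).mp (hcardC k ▸ AddSubgroup.card_dvd_of_le hDle)
  have hDkill : ∀ Q ∈ D, ((p ^ j : ℕ) : ℤ) • Q = 0 := fun Q hQ ↦ by
    have h0 : Nat.card D • (⟨Q, hQ⟩ : D) = 0 := card_nsmul_eq_zero'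
    rw [natCast_zsmul, ← hDcard]
    exact congrArg Subtype.val h0
  have hDj : D ≤ Cr j := fun Q hQ ↦ (hmemC j Q).mpr ⟨((hmemC k Q).mp hQ.1).1, hDkill Q hQ⟩
  haveI : Finite (Cr j) := hfinC j
  have hDeq : D = Cr j := AddSubgroup.eq_of_le_of_card_ge hDj (by rw [hcardC, hDcard])
  -- (3) `τ` fixes `E[p^j]` modulo `ker red₀` (Weil identity for `τ`, `a = 1`)
  obtain ⟨P₁, hP₁C, hord₁, -⟩ := hCrgen j
  have hτP₁ : τ • P₁ = P₁ := ((hmemD P₁).mp (hDeq ▸ hP₁C :)).2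
  have hfixj : ∀ Q : P, ((p ^ j : ℕ) : ℤ) • Q = 0 → red₀ (τ • Q) = red₀ Q := by
    intro Q hQ
    obtain ⟨d, hd⟩ := W.localPoints_exists_nsmul_smul_sub_eq_nsmul F hord₁ (hτfix j) (b := 1)
      (by rw [one_smul]; exact hτP₁) Q hQ
    rw [one_smul] at hd
    have h := congrArg red₀ hd
    rw [map_sub, map_nsmul, ((hmemC j P₁).mp hP₁C).1, smul_zero, sub_eq_zero] at h
    exact h
  -- (4) Hensel: every `σ` fixes `E[p^j]` modulo `ker red₀`
  have hfixσ : ∀ (σ : Γ) (Q : P), ((p ^ j : ℕ) : ℤ) • Q = 0 → red₀ (σ • Q) = red₀ Q := by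
    intro σ Q hQ
    obtain ⟨P₀, hP₀fix, hP₀⟩ := hHensel Q (hfixj Q hQ)
    have h0 : red₀ (Q - P₀) = 0 := by rw [map_sub, hP₀, sub_self]
    have h1 : red₀ (σ • (Q - P₀)) = 0 := hstab σ _ h0
    rw [smul_sub, hP₀fix σ, map_sub, hP₀, sub_eq_zero] at h1
    exact h1
  -- (5) the Weil identity for every `σ` at level `j`, read modulo `ker red₀`: `b σ • y = a σ • y` on `B[p^j]`
  have hPkj : addOrderOf ((p ^ (k - j)) • Pk) = p ^ j := by
    rw [addOrderOf_nsmul_of_dvd (hpr _) (by rw [hPkord]; exact pow_dvd_pow p (Nat.sub_le k j)), hPkord,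
      Nat.pow_div (Nat.sub_le k j) hp.out.pos, Nat.sub_sub_self hjk]
  have hBscalar : ∀ (σ : Γ) (y : B), ((p ^ j : ℕ) : ℤ) • y = 0 → bσ σ • y = aσ σ • y := by
    intro σ y hy
    obtain ⟨Q, hQ, rfl⟩ := hsurj j y hy
    obtain ⟨d, hd⟩ := localPoints_exists_nsmul_smul_sub_nsmul_eq_nsmul W F hPkj (haσ' σ j hjk) (b := bσ σ)
      (by rw [galois_smul_nsmul, hbσ σ, smul_comm]) Q hQ
    have h := congrArg red₀ hd
    rw [map_sub, map_nsmul, map_nsmul, map_nsmul, map_nsmul, hPk0, smul_zero, smul_zero, hfixσ σ Q hQ,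
      sub_eq_zero] at h
    exact h
  -- (6) `B[p^j]` has an element of order `p^j`, so `p^j ∣ b σ − a σ`
  have hBcard : ∀ r : ℕ, Nat.card (B[(p ^ r : ℕ)]) = p ^ r := by
    intro r
    have hsurj' : ∀ y ∈ B[(p ^ r : ℕ)], ∃ x ∈ (localPoints W F)[(p ^ r : ℕ)], red₀ x = y := by
      intro y hy
      obtain ⟨x, hx, hxy⟩ := hsurj r y (mem_torsionBy_iff.mp hy)
      exact ⟨x, mem_torsionBy_iff.mpr hx, hxy⟩
    have hmul := TateModule.card_ker_torsionBy_mul_card red₀ (p ^ r) hsurj'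
    have hA : Nat.card ((localPoints W F)[(p ^ r : ℕ)]) = p ^ r * p ^ r := by
      haveI : PerfectField F := PerfectField.ofCharZero
      have h := card_torsionBy_eq_sq (E := W.baseChange (AlgebraicClosure F)) (n := p ^ r)
        (by exact_mod_cast hpr r)
      rw [sq] at h
      exact h
    have hker : Nat.card ((red₀.ker)[(p ^ r : ℕ)]) = p ^ r := by
      refine Eq.trans (Nat.card_congr (⟨fun x ↦ ⟨((x : red₀.ker) : P),
        (hmemC r _).mpr ⟨(x : red₀.ker).2, ?_⟩⟩, fun y ↦ ⟨⟨(y : P), ((hmemC r _).mp y.2).1⟩, ?_⟩,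
        fun x ↦ rfl, fun y ↦ rfl⟩ : (red₀.ker)[(p ^ r : ℕ)] ≃ Cr r)) (hcardC r)
      · exact congrArg Subtype.val (mem_torsionBy_iff.mp x.2)
      · rw [mem_torsionBy_iff]
        apply Subtype.ext
        exact ((hmemC r _).mp y.2).2
    rw [hker, hA] at hmul
    exact Nat.eq_of_mul_eq_mul_left (Nat.pos_of_ne_zero (hpr r)) hmul
  have hdvd : ∀ σ : Γ, ((p ^ j : ℕ) : ℤ) ∣ ((bσ σ : ℤ) - (aσ σ : ℤ)) := by
    intro σ
    rcases Nat.eq_zero_or_pos j with hj0 | hjpos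
    · rw [hj0, pow_zero, Nat.cast_one]; exact one_dvd _
    -- an element `y ∈ B[p^j] \\ B[p^(j-1)]`
    have hlt : Nat.card (B[(p ^ (j - 1) : ℕ)]) < Nat.card (B[(p ^ j : ℕ)]) := by
      rw [hBcard, hBcard]; exact Nat.pow_lt_pow_right hp.out.one_lt (Nat.sub_lt hjpos one_pos)
    have hle : B[(p ^ (j - 1) : ℕ)] ≤ B[(p ^ j : ℕ)] := by
      intro y hy
      rw [mem_torsionBy_iff] at hy ⊢
      rw [show ((p ^ j : ℕ) : ℤ) = (p : ℤ) * ((p ^ (j - 1) : ℕ) : ℤ) by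
        rw [← Nat.cast_mul (α := ℤ) p, ← pow_succ', Nat.sub_add_cancel hjpos], mul_smul, hy, smul_zero]
    obtain ⟨y, hyj, hyj1⟩ : ∃ y ∈ B[(p ^ j : ℕ)], y ∉ B[(p ^ (j - 1) : ℕ)] := by
      by_contra hall
      push Not at hall
      haveI : Finite (B[(p ^ (j - 1) : ℕ)]) := Nat.finite_of_card_ne_zero (by rw [hBcard]; exact hpr _)
      exact absurd (AddSubgroup.card_le_of_le (show B[(p ^ j : ℕ)] ≤ B[(p ^ (j - 1) : ℕ)] from hall))
        (not_le.mpr hlt)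
    have hyord : addOrderOf y = p ^ j := by
      have h1 : addOrderOf y ∣ p ^ j :=
        addOrderOf_dvd_of_nsmul_eq_zero (by rw [← natCast_zsmul]; exact mem_torsionBy_iff.mp hyj)
      obtain ⟨i, hij, hi⟩ := (Nat.dvd_prime_pow hp.out).mp h1
      have hij' : i = j := by
        by_contra hne
        have hle' : i ≤ j - 1 := Nat.le_sub_one_of_lt (lt_of_le_of_ne hij hne)
        apply hyj1
        rw [mem_torsionBy_iff, natCast_zsmul]
        exact addOrderOf_dvd_iff_nsmul_eq_zero.mp (hi ▸ pow_dvd_pow p hle')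
      rw [hi, hij']
    have hy0 : ((bσ σ : ℤ) - (aσ σ : ℤ)) • y = 0 := by
      rw [sub_smul, natCast_zsmul, natCast_zsmul, hBscalar σ y (mem_torsionBy_iff.mp hyj), sub_self]
    rw [← hyord]
    exact_mod_cast addOrderOf_dvd_iff_zsmul_eq_zero.mpr hy0
  -- (7) the `τ`-fixed classes of `C` and of `μ_{p^k}`: the bijection `f ↦ f(P_k)`
  let T : Type u := {z : MuCarrier F (p ^ k) // bσ τ • z = z}
  -- every `z ∈ T` is killed by `p^j`: transport to `C`, where `{c : b τ • c = c} = D` is killed by `#D = p^j`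
  have hCT : ∀ c : C, bσ τ • c = c → p ^ j • c = 0 := by
    intro c hc
    have hcD : (c : P) ∈ D := ⟨(hCk c).mpr c.2, by rw [hτc τ c, hc]⟩
    have h := hDkill _ hcD
    rw [natCast_zsmul] at h
    exact Subtype.ext (by rw [AddSubmonoidClass.coe_nsmul, ZeroMemClass.coe_zero]; exact h)
  have eC : C ≃+ ZMod (p ^ k) :=
    ((zmodAddCyclicAddEquiv (G := C) hZcyc).symm).trans (ZMod.ringEquivCongr hZcard).toAddEquiv
  let e : MuCarrier F (p ^ k) ≃+ C := (muEquivZMod F (p ^ k)).trans eC.symm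
  have hTkill : ∀ z : MuCarrier F (p ^ k), bσ τ • z = z → p ^ j • z = 0 := by
    intro z hz
    apply e.injective
    rw [map_nsmul, map_zero]
    exact hCT (e z) (by rw [← map_nsmul, hz])
  have hTscalar : ∀ (σ : Γ) (z : MuCarrier F (p ^ k)), bσ τ • z = z → bσ σ • z = aσ σ • z := by
    intro σ z hz
    rw [← sub_eq_zero, ← natCast_zsmul, ← natCast_zsmul, ← sub_smul]
    obtain ⟨q, hq⟩ := hdvd σ
    rw [hq, mul_comm, mul_smul, natCast_zsmul, hTkill z hz, smul_zero]
  -- the map `Ψ : invariants → T`, `f ↦ f(P_k)`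
  have hinv : ∀ (f : (ρ.homRep (mu F (p ^ k))).toTopRep.ρ.invariants) (σ : Γ) (m : C),
      mu F (p ^ k) σ ((f : HomCarrier C (MuCarrier F (p ^ k))) m) =
        (f : HomCarrier C (MuCarrier F (p ^ k))) (ρ σ m) := fun f σ ↦
    (ContinuousRep.homRep_apply_eq_self_iff ρ (mu F (p ^ k)) σ (f : HomCarrier C (MuCarrier F (p ^ k)))).mp (f.2 σ)
  let Ψ : (ρ.homRep (mu F (p ^ k))).toTopRep.ρ.invariants → T := fun f ↦
    ⟨(f : HomCarrier C (MuCarrier F (p ^ k))) Pz, by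
      have h := hinv f τ Pz
      rw [hτω, hρPz, map_nsmul] at h
      exact h.symm⟩
  have hΨinj : Function.Injective Ψ := by
    intro f f' hff'
    have h1 : (f : HomCarrier C (MuCarrier F (p ^ k))) Pz = (f' : HomCarrier C (MuCarrier F (p ^ k))) Pz :=
      congrArg Subtype.val hff'
    refine Subtype.ext (HomCarrier.ext fun m ↦ ?_)
    obtain ⟨i, rfl⟩ := hZgen m
    rw [map_nsmul, map_nsmul, h1]
  have hΨsurj : Function.Surjective Ψ := by
    rintro ⟨z, hz⟩
    -- the additive map `i • P_k ↦ i • z`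
    have hwd : ∀ i i' : ℕ, i • Pz = i' • Pz → i • z = i' • z := by
      intro i i' h
      have hmod : i ≡ i' [MOD p ^ k] := by
        rw [← hPzord]
        exact (IsOfFinAddOrder.nsmul_eq_nsmul_iff_modEq
          (addOrderOf_pos_iff.mp (by rw [hPzord]; exact pow_pos hp.out.pos k))).mp h
      -- `i • z = i' • z` since `p^k • z = 0`
      wlog hle : i ≤ i' generalizing i i'
      · exact (this i' i h.symm hmod.symm (le_of_not_ge hle)).symm
      obtain ⟨d, rfl⟩ := Nat.exists_eq_add_of_le hle
      obtain ⟨q, hq⟩ := (Nat.modEq_iff_dvd' (Nat.le_add_right i d)).mp hmod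
      rw [Nat.add_sub_cancel_left] at hq
      rw [add_nsmul, hq, mul_nsmul, hμp, smul_zero, add_zero]
    have hZgen' := hZgen
    choose idx hidx using hZgen'
    let f₀ : C →+ MuCarrier F (p ^ k) :=
      { toFun := fun c ↦ idx c • z
        map_zero' := by
          have h : idx 0 • Pz = 0 • Pz := by rw [zero_smul, ← hidx 0]
          rw [hwd _ _ h, zero_smul]
        map_add' := fun c c' ↦ by
          have h : idx (c + c') • Pz = (idx c + idx c') • Pz := by
            rw [add_nsmul, ← hidx c, ← hidx c', ← hidx (c + c')]
          rw [hwd _ _ h, add_nsmul] }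
    have hf₀ : ∀ i : ℕ, f₀ (i • Pz) = i • z := fun i ↦ hwd _ _ (by rw [← hidx (i • Pz)])
    have hf₀mem : (HomCarrier.ofAddMonoidHom f₀ : HomCarrier C (MuCarrier F (p ^ k))) ∈
        (ρ.homRep (mu F (p ^ k))).toTopRep.ρ.invariants := by
      intro σ
      refine (ContinuousRep.homRep_apply_eq_self_iff ρ (mu F (p ^ k)) σ _).mpr fun m ↦ ?_
      obtain ⟨i, rfl⟩ := hZgen m
      rw [HomCarrier.ofAddMonoidHom_apply, HomCarrier.ofAddMonoidHom_apply, hρi, hf₀, hf₀, hσω, ← smul_smul,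
        hTscalar σ z hz]
      exact smul_comm _ _ _
    refine ⟨⟨_, hf₀mem⟩, Subtype.ext ?_⟩
    change f₀ Pz = z
    have h := hf₀ 1
    rwa [one_smul, one_smul] at h
  -- (8) count: `#invariants = #T = #{c ∈ C : b τ • c = c} = #{c ∈ C : τ c = c}`
  have hT : Nat.card (ρ.homRep (mu F (p ^ k))).toTopRep.ρ.invariants = Nat.card T :=
    Nat.card_congr (Equiv.ofBijective Ψ ⟨hΨinj, hΨsurj⟩)
  have hTC : Nat.card T = Nat.card {c : C // bσ τ • c = c} :=
    Nat.card_congr (e.toEquiv.subtypeEquiv fun z ↦ by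
      change bσ τ • z = z ↔ bσ τ • e z = e z
      rw [← map_nsmul]
      exact ⟨fun h ↦ congrArg e h, fun h ↦ e.injective h⟩)
  rw [hT, hTC]
  refine Nat.card_congr (Equiv.subtypeEquivRight fun c ↦ ?_)
  rw [hτc τ c]
  exact ⟨fun h ↦ by rw [h], fun h ↦ Subtype.ext h⟩

end Summit.BirchSwinnertonDyer.BirchSwinnertonDyer.Theorems.InputsGreenbergLemma34

end
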